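import Literature.AlgebraicGeometry.Frobenioids.ModelFrobenioidPullbacks
import HarnessLib

/-!
# Frobenioids I, Theorem 5.2 (ii), first sentence — part 2: division lemmas and clauses
# (i), (ii) of Definition 1.3 for the model Frobenioid (abc-iut cell, layer L1, node F-D1a)

Mochizuki, *The geometry of Frobenioids I: the general theory*, Kyushu J. Math. **62** (2008)
293–400, §5, Theorem 5.2 (ii), kurims text p. 101 [cite: MochizukiFrdI2008, Thm. 5.2(ii) p.101]
("a routine verification … reminiscent of … Proposition 1.5, (i)").

Two bookkeeping lemmas do most of the routine work: if the data `(m, g, w, t)` composed with a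
morphism `φ` whose projection to `D` is an isomorphism (on the right), or with a linear morphism
`ψ'` (on the left), give the data of an actual morphism, then `(m, g, w, t)` satisfies relation (d)
of Thm. 5.2 (i), i.e. is itself a morphism (`divRight`, `divLeft`). With these we verify
Def. 1.3 (i) (a)–(c) and (ii) for `C → F_Φ` (and the observation of the proof, p. 101, that the
objects with `α = 0` are Frobenius-trivial); (iii) is in `ModelFrobenioidOrder.lean`, (iv)–(vii) and
the theorem in `ModelFrobenioidIsFrobenioid.lean`. Hypotheses as printed in Thm. 5.2 (each lemma takes the ones it
uses). No statement of the paper is strengthened.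
-/

noncomputable section

namespace Literature.AlgebraicGeometry.Frobenioids

namespace ModelFrobenioid

open CategoryTheory Opposite
open PreFrobenioid (pullGp_of' pullGp_inv_pullGp pullGp_pullGp_inv pullGp_injective)

universe w v u

variable {D : Type u} [Category.{v} D] {Φ B : Dᵒᵖ ⥤ CommMonCat.{w}} {DivB : B ⟶ monoidGp Φ}

/-! ### Division lemmas -/

section Division

variable {A Bo B' : ModelFrobenioid Φ B DivB}

/-- Right division along a base-isomorphism: if `(m, g, w, t) ∘ φ` is the data of a morphism `φ'`
and `Base(φ)` is invertible, then `(m, g, w, t)` satisfies relation (d).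
[cite: MochizukiFrdI2008, Thm. 5.2(ii) p.101] -/
theorem rel_divRight (φ : A ⟶ Bo) [IsIso (baseMap φ)] (φ' : A ⟶ B') (m : ℕ+)
    (g : Bo.base ⟶ B'.base) (w : Φ.obj (op Bo.base)) (t : B.obj (op Bo.base))
    (hn : degFr φ' = m * degFr φ) (hb : baseMap φ' = baseMap φ ≫ g)
    (hd : div φ' = pull Φ (baseMap φ) w * div φ ^ (m : ℕ))
    (hu : unit φ' = pull B (baseMap φ) t * unit φ ^ (m : ℕ)) :
    Bo.cls ^ (m : ℕ) * Algebra.GrothendieckGroup.of w = pullGp Φ g B'.cls * divB Φ B DivB _ t := by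
  apply pullGp_injective (baseMap φ)
  apply mul_right_cancel (b := divB Φ B DivB _ (unit φ) ^ (m : ℕ))
  have E := rel φ
  have E' := rel φ'
  rw [hn, hb, hd, hu, PNat.mul_coe, pullGp_comp, map_mul (divB Φ B DivB _), map_pow] at E'
  calc pullGp Φ (baseMap φ) (Bo.cls ^ (m : ℕ) * Algebra.GrothendieckGroup.of w) *
        divB Φ B DivB _ (unit φ) ^ (m : ℕ)
      = (pullGp Φ (baseMap φ) Bo.cls * divB Φ B DivB _ (unit φ)) ^ (m : ℕ) *
          Algebra.GrothendieckGroup.of (pull Φ (baseMap φ) w) := by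
        rw [map_mul, map_pow, pullGp_of', mul_pow, mul_right_comm]
    _ = A.cls ^ ((m : ℕ) * (degFr φ : ℕ)) *
          Algebra.GrothendieckGroup.of (pull Φ (baseMap φ) w * div φ ^ (m : ℕ)) := by
        rw [← E, mul_pow, ← pow_mul', map_mul, map_pow, mul_assoc,
          mul_comm (Algebra.GrothendieckGroup.of (div φ) ^ (m : ℕ))]
    _ = pullGp Φ (baseMap φ) (pullGp Φ g B'.cls) *
          (divB Φ B DivB _ (pull B (baseMap φ) t) * divB Φ B DivB _ (unit φ) ^ (m : ℕ)) := E'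
    _ = pullGp Φ (baseMap φ) (pullGp Φ g B'.cls * divB Φ B DivB _ t) *
          divB Φ B DivB _ (unit φ) ^ (m : ℕ) := by
        rw [map_mul (pullGp Φ (baseMap φ)), pullGp_divB_pull, mul_assoc]

/-- The right quotient `φ' / φ` as a morphism `Bo → B'`. [cite: MochizukiFrdI2008, Thm. 5.2(ii) p.101] -/
def divRight (φ : A ⟶ Bo) [IsIso (baseMap φ)] (φ' : A ⟶ B') (m : ℕ+)
    (g : Bo.base ⟶ B'.base) (w : Φ.obj (op Bo.base)) (t : B.obj (op Bo.base))
    (hn : degFr φ' = m * degFr φ) (hb : baseMap φ' = baseMap φ ≫ g)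
    (hd : div φ' = pull Φ (baseMap φ) w * div φ ^ (m : ℕ))
    (hu : unit φ' = pull B (baseMap φ) t * unit φ ^ (m : ℕ)) : Bo ⟶ B' :=
  mkHom Bo B' m g w t (rel_divRight φ φ' m g w t hn hb hd hu)

/-- `(φ' / φ) ∘ φ = φ'`. [cite: MochizukiFrdI2008, Thm. 5.2(ii) p.101] -/
theorem comp_divRight (φ : A ⟶ Bo) [IsIso (baseMap φ)] (φ' : A ⟶ B') (m : ℕ+)
    (g : Bo.base ⟶ B'.base) (w : Φ.obj (op Bo.base)) (t : B.obj (op Bo.base))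
    (hn : degFr φ' = m * degFr φ) (hb : baseMap φ' = baseMap φ ≫ g)
    (hd : div φ' = pull Φ (baseMap φ) w * div φ ^ (m : ℕ))
    (hu : unit φ' = pull B (baseMap φ) t * unit φ ^ (m : ℕ)) :
    φ ≫ divRight φ φ' m g w t hn hb hd hu = φ' :=
  hom_ext hn.symm hb.symm hd.symm hu.symm

/-- Left division by a linear morphism: if `ψ' ∘ (m, g, w, t)` is the data of a morphism `ψ` and
`deg_Fr(ψ') = 1`, then `(m, g, w, t)` satisfies relation (d). [cite: MochizukiFrdI2008, Thm. 5.2(ii) p.101] -/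
theorem rel_divLeft (ψ' : B' ⟶ A) (hψ' : degFr ψ' = 1) (ψ : Bo ⟶ A) (m : ℕ+)
    (g : Bo.base ⟶ B'.base) (w : Φ.obj (op Bo.base)) (t : B.obj (op Bo.base))
    (hn : degFr ψ = m) (hb : baseMap ψ = g ≫ baseMap ψ') (hd : div ψ = pull Φ g (div ψ') * w)
    (hu : unit ψ = pull B g (unit ψ') * t) :
    Bo.cls ^ (m : ℕ) * Algebra.GrothendieckGroup.of w = pullGp Φ g B'.cls * divB Φ B DivB _ t := by
  have E := rel ψ
  rw [hn, hb, hd, hu, pullGp_comp, map_mul Algebra.GrothendieckGroup.of, map_mul (divB Φ B DivB _)] at E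
  have E' := congrArg (pullGp Φ g) (rel ψ')
  rw [hψ', PNat.one_coe, pow_one, map_mul, map_mul, pullGp_of', pullGp_divB_pull] at E'
  apply mul_right_cancel (b := Algebra.GrothendieckGroup.of (pull Φ g (div ψ')))
  calc Bo.cls ^ (m : ℕ) * Algebra.GrothendieckGroup.of w * Algebra.GrothendieckGroup.of (pull Φ g (div ψ'))
      = Bo.cls ^ (m : ℕ) * (Algebra.GrothendieckGroup.of (pull Φ g (div ψ')) *
          Algebra.GrothendieckGroup.of w) := by
        rw [mul_assoc, mul_comm (Algebra.GrothendieckGroup.of w)]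
    _ = pullGp Φ g (pullGp Φ (baseMap ψ') A.cls) *
          (divB Φ B DivB _ (pull B g (unit ψ')) * divB Φ B DivB _ t) := E
    _ = pullGp Φ g (pullGp Φ (baseMap ψ') A.cls) * divB Φ B DivB _ (pull B g (unit ψ')) *
          divB Φ B DivB _ t := (mul_assoc _ _ _).symm
    _ = pullGp Φ g B'.cls * Algebra.GrothendieckGroup.of (pull Φ g (div ψ')) * divB Φ B DivB _ t := by
        rw [← E']
    _ = pullGp Φ g B'.cls * divB Φ B DivB _ t * Algebra.GrothendieckGroup.of (pull Φ g (div ψ')) :=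
        mul_right_comm _ _ _

/-- The left quotient `ψ'⁻¹ ∘ ψ` as a morphism `Bo → B'`. [cite: MochizukiFrdI2008, Thm. 5.2(ii) p.101] -/
def divLeft (ψ' : B' ⟶ A) (hψ' : degFr ψ' = 1) (ψ : Bo ⟶ A) (m : ℕ+)
    (g : Bo.base ⟶ B'.base) (w : Φ.obj (op Bo.base)) (t : B.obj (op Bo.base))
    (hn : degFr ψ = m) (hb : baseMap ψ = g ≫ baseMap ψ') (hd : div ψ = pull Φ g (div ψ') * w)
    (hu : unit ψ = pull B g (unit ψ') * t) : Bo ⟶ B' :=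
  mkHom Bo B' m g w t (rel_divLeft ψ' hψ' ψ m g w t hn hb hd hu)

/-- `ψ' ∘ (ψ'⁻¹ ∘ ψ) = ψ`. [cite: MochizukiFrdI2008, Thm. 5.2(ii) p.101] -/
theorem divLeft_comp (ψ' : B' ⟶ A) (hψ' : degFr ψ' = 1) (ψ : Bo ⟶ A) (m : ℕ+)
    (g : Bo.base ⟶ B'.base) (w : Φ.obj (op Bo.base)) (t : B.obj (op Bo.base))
    (hn : degFr ψ = m) (hb : baseMap ψ = g ≫ baseMap ψ') (hd : div ψ = pull Φ g (div ψ') * w)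
    (hu : unit ψ = pull B g (unit ψ') * t) :
    divLeft ψ' hψ' ψ m g w t hn hb hd hu ≫ ψ' = ψ :=
  hom_ext
    (by
      show degFr ψ' * m = degFr ψ
      rw [hψ', one_mul, hn])
    hb.symm
    (by
      show pull Φ g (div ψ') * w ^ (degFr ψ' : ℕ) = div ψ
      rw [hψ', PNat.one_coe, pow_one, hd])
    (by
      show pull B g (unit ψ') * t ^ (degFr ψ' : ℕ) = unit ψ
      rw [hψ', PNat.one_coe, pow_one, hu])

end Division

/-! ### Definition 1.3 (i) -/

section Clauses

variable {A Bo B' : ModelFrobenioid Φ B DivB}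

/-- The objects `(A_D, 0)` are Frobenius-trivial (proof of Thm. 5.2, p. 101: "the objects
`A = (A_D, α)` such that `α = 0` are Frobenius-trivial"). [cite: MochizukiFrdI2008, Thm. 5.2 p.101] -/
theorem isFrobeniusTrivial_zeroObj (hBg : Objectwise (fun M _ => IsGroupLike M) B) (A₀ : D) :
    PreFrobenioid.IsFrobeniusTrivial (toElem Φ B DivB) (zeroObj Φ B DivB A₀) :=
  ⟨frobeniusEndHom A₀, fun _ => ⟨rfl, rfl, ⟨isCoAngular hBg _, rfl⟩,
    show IsIso (𝟙 A₀) from inferInstance⟩⟩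

/-- An object whose class `α` is `0` is Frobenius-trivial. [cite: MochizukiFrdI2008, Thm. 5.2 p.101] -/
theorem isFrobeniusTrivial_of_cls_eq_one (hBg : Objectwise (fun M _ => IsGroupLike M) B)
    (X : ModelFrobenioid Φ B DivB) (hX : X.cls = 1) :
    PreFrobenioid.IsFrobeniusTrivial (toElem Φ B DivB) X := by
  obtain ⟨A₀, α⟩ := X
  have hα : α = 1 := hX
  subst hα
  exact isFrobeniusTrivial_zeroObj hBg A₀

/-- Def. 1.3 (i)(a): every object of `D` is the base of the Frobenius-trivial object `(A_D, 0)`.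
[cite: MochizukiFrdI2008, Thm. 5.2(ii) p.101] -/
theorem i_a (hBg : Objectwise (fun M _ => IsGroupLike M) B) (A₀ : D) :
    ∃ X : ModelFrobenioid Φ B DivB, PreFrobenioid.IsFrobeniusTrivial (toElem Φ B DivB) X ∧
      Nonempty (PreFrobenioid.baseObj (toElem Φ B DivB) X ≅ A₀) :=
  ⟨zeroObj Φ B DivB A₀, isFrobeniusTrivial_zeroObj hBg A₀, ⟨Iso.refl _⟩⟩

/-- An auxiliary commutative-group identity. [folklore] -/
private theorem frac_aux {G : Type w} [CommGroup G] {ξ x y : G} (h : ξ * y = x) (z : G) :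
    y⁻¹ * z⁻¹ * (x * z) = ξ := by
  rw [← h, mul_mul_mul_comm, inv_mul_cancel, mul_one, mul_comm ξ y, inv_mul_cancel_left]

/-- Def. 1.3 (i)(b): a base-isomorphism `e : A_D ⥲ B_D` is `Base(ψ) ∘ Base(φ)⁻¹` for the pre-steps
`φ = (1, id, a₁ + b₂, 0)`, `ψ = (1, e, b₁ + a₂, 0)` out of `(A_D, −a₂ − b₂)`, where `α = a₁ − a₂`,
`e^*β = b₁ − b₂`. [cite: MochizukiFrdI2008, Thm. 5.2(ii) p.101] -/
theorem i_b (A Bo : ModelFrobenioid Φ B DivB)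
    (e : PreFrobenioid.baseObj (toElem Φ B DivB) A ≅ PreFrobenioid.baseObj (toElem Φ B DivB) Bo) :
    ∃ (X : ModelFrobenioid Φ B DivB) (φ : X ⟶ A) (ψ : X ⟶ Bo),
      PreFrobenioid.IsPreStep (toElem Φ B DivB) φ ∧ PreFrobenioid.IsPreStep (toElem Φ B DivB) ψ ∧
        PreFrobenioid.Base (toElem Φ B DivB) φ ≫ e.hom = PreFrobenioid.Base (toElem Φ B DivB) ψ := by
  let e₀ : A.base ⟶ Bo.base := e.hom
  haveI : IsIso e₀ := (inferInstance : IsIso e.hom)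
  obtain ⟨a₁, a₂, ha⟩ := gp_exists_mul_of_eq_of A.cls
  obtain ⟨b₁, b₂, hb⟩ := gp_exists_mul_of_eq_of (pullGp Φ e₀ Bo.cls)
  let X : ModelFrobenioid Φ B DivB :=
    ⟨A.base, (Algebra.GrothendieckGroup.of a₂)⁻¹ * (Algebra.GrothendieckGroup.of b₂)⁻¹⟩
  refine ⟨X, mkHom X A 1 (𝟙 _) (a₁ * b₂) 1 ?_, mkHom X Bo 1 e₀ (b₁ * a₂) 1 ?_,
    ⟨rfl, show IsIso (𝟙 A.base) from inferInstance⟩, ⟨rfl, show IsIso e₀ from inferInstance⟩,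
    Category.id_comp _⟩
  · show ((Algebra.GrothendieckGroup.of a₂)⁻¹ * (Algebra.GrothendieckGroup.of b₂)⁻¹) ^ ((1 : ℕ+) : ℕ) *
        Algebra.GrothendieckGroup.of (a₁ * b₂) = pullGp Φ (𝟙 A.base) A.cls * divB Φ B DivB _ 1
    rw [PNat.one_coe, pow_one, pullGp_id, map_one, mul_one, map_mul]
    exact frac_aux ha _
  · show ((Algebra.GrothendieckGroup.of a₂)⁻¹ * (Algebra.GrothendieckGroup.of b₂)⁻¹) ^ ((1 : ℕ+) : ℕ) *
        Algebra.GrothendieckGroup.of (b₁ * a₂) = pullGp Φ e₀ Bo.cls * divB Φ B DivB _ 1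
    rw [PNat.one_coe, pow_one, map_one, mul_one, map_mul, mul_comm (Algebra.GrothendieckGroup.of a₂)⁻¹]
    exact frac_aux hb _

/-- Def. 1.3 (i)(c): `C^pl-bk_A → D_{A_D}` is an equivalence (faithful and full formally;
essentially surjective via `g ↦ (1, g, 0, 0) : (X_D, g^*α) → (A_D, α)`).
[cite: MochizukiFrdI2008, Thm. 5.2(ii) p.101] -/
theorem i_c (hΦd : Objectwise (fun M _ => IsDivisorial M) Φ)
    (hBg : Objectwise (fun M _ => IsGroupLike M) B) (A : ModelFrobenioid Φ B DivB) :
    (PreFrobenioid.pullbackSliceToBase (toElem Φ B DivB) A).IsEquivalence := by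
  haveI := PreFrobenioid.pullbackSliceToBase_faithful (toElem Φ B DivB) A
  haveI := PreFrobenioid.pullbackSliceToBase_full (toElem Φ B DivB) A
  haveI : (PreFrobenioid.pullbackSliceToBase (toElem Φ B DivB) A).EssSurj := by
    refine ⟨fun Y => ?_⟩
    let g : Y.left ⟶ A.base := Y.hom
    let X : ModelFrobenioid Φ B DivB := ⟨Y.left, pullGp Φ g A.cls⟩
    let φ : X ⟶ A := mkHom X A 1 g 1 1 (by
      show pullGp Φ g A.cls ^ ((1 : ℕ+) : ℕ) * Algebra.GrothendieckGroup.of 1 =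
        pullGp Φ g A.cls * divB Φ B DivB _ 1
      rw [PNat.one_coe, pow_one, map_one, mul_one, map_one, mul_one])
    have hpb : PreFrobenioid.IsPullbackMorphism (toElem Φ B DivB) φ :=
      isPullbackMorphism_of hΦd hBg rfl rfl
    exact ⟨Over.mk (⟨φ, hpb⟩ : (⟨X⟩ : PreFrobenioid.PullbackCat (toElem Φ B DivB)) ⟶ ⟨A⟩),
      ⟨Over.isoMk (Iso.refl _) (Category.id_comp _)⟩⟩
  exact {}

/-! ### Definition 1.3 (ii) -/

/-- Def. 1.3 (ii), existence: `(n, id, 0, 0) : (A_D, α) → (A_D, n · α)` is of Frobenius type of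
degree `n`. [cite: MochizukiFrdI2008, Thm. 5.2(ii) p.101] -/
theorem ii_exists (hBg : Objectwise (fun M _ => IsGroupLike M) B) (A : ModelFrobenioid Φ B DivB) (n : ℕ+) :
    ∃ (Bo : ModelFrobenioid Φ B DivB) (φ : A ⟶ Bo),
      PreFrobenioid.IsFrobeniusType (toElem Φ B DivB) φ ∧ PreFrobenioid.degFr (toElem Φ B DivB) φ = n := by
  let Bo : ModelFrobenioid Φ B DivB := ⟨A.base, A.cls ^ (n : ℕ)⟩
  refine ⟨Bo, mkHom A Bo n (𝟙 _) 1 1 ?_, ⟨⟨isCoAngular hBg _, rfl⟩,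
    show IsIso (𝟙 A.base) from inferInstance⟩, rfl⟩
  show A.cls ^ (n : ℕ) * Algebra.GrothendieckGroup.of 1 = pullGp Φ (𝟙 A.base) (A.cls ^ (n : ℕ)) *
    divB Φ B DivB _ 1
  rw [map_one, mul_one, pullGp_id, map_one, mul_one]

/-- Def. 1.3 (ii), essential uniqueness: two morphisms of Frobenius type of the same degree out
of `A` differ by the isomorphism `ψ / φ = (1, Base(φ)⁻¹ Base(ψ), 0, Base(φ)⁻¹^*(u_ψ − u_φ))`.
[cite: MochizukiFrdI2008, Thm. 5.2(ii) p.101] -/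
theorem ii_unique (hBg : Objectwise (fun M _ => IsGroupLike M) B) (φ : A ⟶ Bo) (ψ : A ⟶ B')
    (hφ : PreFrobenioid.IsFrobeniusType (toElem Φ B DivB) φ)
    (hψ : PreFrobenioid.IsFrobeniusType (toElem Φ B DivB) ψ)
    (hn : PreFrobenioid.degFr (toElem Φ B DivB) φ = PreFrobenioid.degFr (toElem Φ B DivB) ψ) :
    ∃ β : Bo ≅ B', φ ≫ β.hom = ψ := by
  haveI : IsIso (baseMap φ) := hφ.2
  haveI : IsIso (baseMap ψ) := hψ.2
  have hdφ : div φ = 1 := hφ.1.2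
  have hdψ : div ψ = 1 := hψ.1.2
  have hn' : degFr φ = degFr ψ := hn
  obtain ⟨uu, huu⟩ := (hBg A.base).isUnit (unit φ)
  have e₁ : degFr ψ = 1 * degFr φ := by rw [one_mul, hn']
  have e₂ : baseMap ψ = baseMap φ ≫ inv (baseMap φ) ≫ baseMap ψ := by rw [IsIso.hom_inv_id_assoc]
  have e₃ : div ψ = pull Φ (baseMap φ) 1 * div φ ^ ((1 : ℕ+) : ℕ) := by
    rw [map_one, one_mul, PNat.one_coe, pow_one, hdφ, hdψ]
  have e₄ : unit ψ = pull B (baseMap φ) (pull B (inv (baseMap φ)) (unit ψ * ↑uu⁻¹)) *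
      unit φ ^ ((1 : ℕ+) : ℕ) := by
    rw [← pull_comp, IsIso.hom_inv_id, pull_id, PNat.one_coe, pow_one, ← huu, Units.inv_mul_cancel_right]
  let θ : Bo ⟶ B' := divRight φ ψ 1 (inv (baseMap φ) ≫ baseMap ψ) 1
    (pull B (inv (baseMap φ)) (unit ψ * ↑uu⁻¹)) e₁ e₂ e₃ e₄
  haveI : IsIso (baseMap θ) := (inferInstance : IsIso (inv (baseMap φ) ≫ baseMap ψ))
  haveI : IsIso θ := isIso_of hBg θ rfl rfl
  exact ⟨asIso θ, comp_divRight φ ψ _ _ _ _ e₁ e₂ e₃ e₄⟩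

end Clauses

end ModelFrobenioid

end Literature.AlgebraicGeometry.Frobenioids
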